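import Literature.AlgebraicGeometry.Morphisms.ProjectiveOfFibreEmbedding
import Literature.AlgebraicGeometry.Morphisms.SectionsBaseChangeThroughPrime
import Literature.AlgebraicGeometry.Morphisms.SectionsBaseChangeSpan
import Literature.AlgebraicGeometry.Morphisms.ProjectiveOfFibreSpan
import Literature.AlgebraicGeometry.Motives.GeneratingSectionsClosedImmersionBaseChange
import Literature.AlgebraicGeometry.Modules.CohomologyFlatBaseChange
import Literature.AlgebraicGeometry.Morphisms.FlatFpqcDescent
import Literature.AlgebraicGeometry.Motives.GeneratingSectionsFrameChange
import HarnessLib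

/-!
# The very-ample locus is open, AFFINE NOETHERIAN BASE: a fibre embedded by its own sections of a line bundle `E`, with `H¹`-type
# vanishing there, has an affine neighbourhood over which the global sections of `E` embed EVERY fibre (cf. [EGAIII1] Thm. 4.7.1)

Topic `AlgebraicGeometry/ProjectiveGeometry`; namespace `Literature.AlgebraicGeometry.Morphisms`.  THEOREMS ONLY (no definition, no named
fact, no instance, no notation, no `sorry`); universe `Scheme.{0}` (the universe of the tree's cohomology-and-base-change bricks).
Cell `hodgecm-mathlib` (D-0151), P6 «MOD programme», organ «AmpleLocusOpen» (LEAD F0P6-plan (g2) RULING 2026-09-01 22:00:28Z / 22:26:05Z;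
B-p10 (g29)); consumers: the abelian-scheme ample locus (`AbelianSchemes/AbelianSchemeAmpleLocusOpen`, ★ `PolarizationSpreadStage` §3
`hopen`), E6-Π.  Count-neutral: HC_CM is proved only modulo the printed citations until rung 0 closes — nothing here bears on a summit.

THE PRINT.  [EGAIII1] Thm. (4.7.1) (p. 145): «`Y` localement noethérien, `f : X → Y` PROPRE, `ℒ` inversible, `ℒ_y` ample sur `X_y`
⇒ un voisinage ouvert `U ∋ y` tel que `ℒ|f⁻¹(U)` soit ample pour `f⁻¹(U) → U`» (= [GortzWedhorn2023] Thm. 24.46, [StacksProject] Tag 0D2N).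
WHAT IS PROVED — a special case with a DIFFERENT SPINE (flat + `H¹`, Mumford §5, instead of EGA's 𝔪-adic argument), in the tree's
very-ample currency (★ `Motives/GeneratingSectionsOfLineBundle`: a rank-one FRAMED module `E`, finitely many sections, the morphism
`toProj` to `ℙⁿ` they define; the tree has no module-level «ample» predicate and none is introduced):
for `f : X → T` PROPER and FLAT over a LOCALLY NOETHERIAN `T` and `x ∈ T`, if over ONE field-valued point `Spec K → T` centred at `x`
the fibre `X₁` has `Ext¹(𝒪_{X₁}, E|_{X₁}) = 0` and is embedded into `ℙⁿ_K` by finitely many of its own sections of `E|_{X₁}`, then over an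
OPEN `U ∋ x` EVERY fibre `X_y` (`y : Spec K′ → T` landing in `U`, `K′` any ring, any cartesian square) is embedded into some `ℙ^m_{K′}` by
finitely many of its own sections of `E|_{X_y}` — the locally Noetherian head is ★∕sequel `ProjectiveGeometry/AmpleLocusOpen`
(`exists_opens_forall_fibre_isClosedImmersion_toProj`); THIS FILE is its affine Noetherian core with the global sections exposed:
**`exists_globalSections_isClosedImmersion_toProj_away_of_fieldExtension`** (closed immersion `X_g ×_{A_g} (A_g)_r ↪ ℙ^m_{(A_g)_r}` by
global sections `b_j ∈ Γ(X, E)`) and **`exists_opens_forall_isClosedImmersion_toProj_of_fieldExtension`** (an open `U ∋ 𝔭` over which the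
`b_j` embed every ring-valued fibre).

ASSEMBLY (all ★, by name): the `Ext¹`-vanishing descends to the `κ(𝔭)`-fibre (★ `Modules.subsingleton_ext_unit_succ_iff_of_isPullback_specMap`,
[GortzWedhorn2023] Cor. 22.91); `H⁰` then commutes with base change through `Spec A_𝔭` (★ `exists_tensor_secMod_top_linearEquiv_through_prime`,
[MumfordAV1970] §5 Cor. 3), so the restricted global sections span the `K`-fibre's sections (★ `span_range_unitSectionLE_eq_top_of_exists_linearEquiv`)
and finitely many of them embed it (★ `isClosedImmersion_toProj_comap_of_span`); closed immersions of `toProj` DESCEND along `Spec K → Spec κ(𝔭)`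
(★ `GeneratingSections.isClosedImmersion_toProj_of_comap`, [StacksProject] Tag 02L6) and spread to `Spec (A_g)_r` (★
`exists_isClosedImmersion_toProj_ofFrameSystem_away`, [EGAIII1] 4.7.1 core + Prop. 4.6.7 (ii)), then base-change UP to every point of it
(★ `GeneratingSections.isClosedImmersion_toProj_comap`).

## References
* [EGAIII1] A. Grothendieck, J. Dieudonné, *EGA III₁*, Publ. Math. IHÉS 11 (1961), Thm. (4.7.1) (p. 145), Prop. (4.6.7) (ii).
* [GortzWedhorn2023] U. Görtz, T. Wedhorn, *Algebraic Geometry II* (2023), Thm. 24.46 (p. 397), Cor. 22.91.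
* [MumfordAV1970] D. Mumford, *Abelian Varieties* (1970), §5 Cor. 3 (p. 53).
* [Hartshorne1977] R. Hartshorne, *Algebraic Geometry* (1977), II Thm. 7.1, III Thm. 12.11 (p. 290).
* [StacksProject] The Stacks Project, Tags 0D2N, 0D2S (the statement), 02L6 (descent of closed immersions).
-/

noncomputable section

-- `TopCat.Presheaf`/`Scheme.Modules` and pull-back bookkeeping (as in ★ `Morphisms/ProjectiveOfFibreEmbedding`).
set_option backward.isDefEq.respectTransparency false

open CategoryTheory CategoryTheory.Limits CategoryTheory.Abelian AlgebraicGeometry TopologicalSpace Opposite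
open Literature.AlgebraicGeometry.Modules
open Literature.AlgebraicGeometry.Motives Literature.AlgebraicGeometry.Motives.GeneratingSections


namespace Literature.AlgebraicGeometry.Morphisms

/-! ## §0 Bookkeeping -/

/-- **Finitely many elements of a module spanned by a family lie in the span of ONE finite `Fin`-indexed sub-family**
(union of the supports, padded by a default index). [folklore] -/
private theorem exists_fin_subfamily_of_span_eq_top {R M J : Type*} [Semiring R] [AddCommMonoid M] [Module R M]
    [Inhabited J] (η : J → M) (hη : Submodule.span R (Set.range η) = ⊤) {n : ℕ} (s : Fin (n + 1) → M) :
    ∃ (m : ℕ) (τ : Fin (m + 1) → J), ∀ i, s i ∈ Submodule.span R (Set.range fun j ↦ η (τ j)) := by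
  classical
  have hmem : ∀ i, ∃ ci : J →₀ R, (ci.sum fun j a => a • η j) = s i := fun i ↦
    Finsupp.mem_span_range_iff_exists_finsupp.mp (by rw [hη]; exact Submodule.mem_top)
  choose ci hci using hmem
  let T : Finset J := Finset.univ.biUnion fun i ↦ (ci i).support
  have hT : ∀ i, (ci i).support ⊆ T := fun i ↦ Finset.subset_biUnion_of_mem (fun i ↦ (ci i).support) (Finset.mem_univ i)
  let e : T ≃ Fin T.card := T.equivFin
  refine ⟨T.card, Fin.snoc (fun j ↦ (e.symm j : J)) default, fun i ↦ ?_⟩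
  rw [← hci i]
  refine Submodule.finsuppSum_mem _ _ _ _ fun j hj ↦ Submodule.smul_mem _ _ (Submodule.subset_span ?_)
  refine ⟨Fin.castSucc (e ⟨j, hT i (Finsupp.mem_support_iff.mpr hj)⟩), ?_⟩
  simp only [Fin.snoc_castSucc, Equiv.symm_apply_apply]

/-- In a cartesian square `fst ≫ f = snd ≫ g`, a point `x` with `f x = g y` is hit by `fst` (Mathlib
`Scheme.Pullback.exists_preimage_pullback`, transported along `IsPullback.isoPullback`). [folklore] -/
private theorem exists_eq_fst_of_isPullback' {P X' Y Z : Scheme.{0}} {fst : P ⟶ X'} {snd : P ⟶ Y} {f : X' ⟶ Z}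
    {g : Y ⟶ Z} (h : IsPullback fst snd f g) (x : X') (y : Y) (hxy : f x = g y) : ∃ p : P, fst p = x := by
  haveI : HasPullback f g := h.hasPullback
  obtain ⟨z, hz, -⟩ := Scheme.Pullback.exists_preimage_pullback x y hxy
  refine ⟨h.isoPullback.inv z, ?_⟩
  rw [← Scheme.Hom.comp_apply, IsPullback.isoPullback_inv_fst, hz]


/-- `Ext`-vanishing transports along an isomorphism of the second argument. [folklore] -/
private theorem subsingleton_ext_of_iso' {C : Type*} [Category C] [Abelian C] [HasExt.{1} C] (P : C) {Y Y' : C}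
    (e : Y ≅ Y') (i : ℕ) (h : Subsingleton (Ext.{1} P Y' i)) : Subsingleton (Ext.{1} P Y i) := by
  refine subsingleton_of_forall_eq 0 fun x => ?_
  have hx : x = (x.comp (Ext.mk₀ e.hom) (add_zero i)).comp (Ext.mk₀ e.inv) (add_zero i) := by
    rw [Ext.comp_assoc_of_second_deg_zero, Ext.mk₀_comp_mk₀, e.hom_inv_id, Ext.comp_mk₀_id]
  rw [hx, Subsingleton.elim (x.comp (Ext.mk₀ e.hom) (add_zero i)) 0, Ext.zero_comp]

/-! ## §1 Affine Noetherian base: the global sections embed a neighbourhood of a fibre embedded over a field extension -/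

section Away

variable {A : Type} [CommRing A] [IsNoetherianRing A] {X : Scheme.{0}} (f : X ⟶ Spec (.of A)) [IsProper f] [Flat f]
  {E : X.Modules} (F : FrameSystem E) (h1 : ∀ x, F.rank x = 1) (𝔭 : PrimeSpectrum A)
  {K : Type} [Field K] (φ : 𝔭.asIdeal.ResidueField →+* K)
  {X₁ : Scheme.{0}} {i₁ : X₁ ⟶ X} {f₁ : X₁ ⟶ Spec (.of K)}
  (H₁ : IsPullback i₁ f₁ f
    (Spec.map (CommRingCat.ofHom φ) ≫ Spec.map (CommRingCat.ofHom (algebraMap A 𝔭.asIdeal.ResidueField))))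
  (hvan : Subsingleton (Ext.{1} (unitModule X₁) ((Scheme.Modules.pullback i₁).obj E) 1))
  (h1₁ : ∀ x, (F.pullback i₁).rank x = 1) {n : ℕ} (s : Fin (n + 1) → Γ((Scheme.Modules.pullback i₁).obj E, ⊤))
  (hcov : ⨆ i, ⨆ x, X₁.basicOpen ((CocycleSections.ofFrameSystem (F.pullback i₁) h1₁ s).coeff i x) = ⊤)
  (H : IsClosedImmersion ((ofCocycleSections (F.pullback i₁).U
    (CocycleSections.ofFrameSystem (F.pullback i₁) h1₁ s) hcov).toProj f₁))

include H₁ hvan H in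
/-- **EGA III 4.7.1 (very-ample currency, fibre over a field EXTENSION), affine Noetherian base.**  `f : X → Spec A` proper and
flat, `A` Noetherian, `E` an `𝒪_X`-module with a rank-one frame system `F` (a line bundle with chosen local generators),
`𝔭 ∈ Spec A`, `κ(𝔭) → K` a field extension and `X₁ = X ×_A Spec K` ANY cartesian square over `Spec K → Spec κ(𝔭) → Spec A`.  IF
`Ext¹(𝒪_{X₁}, E|_{X₁}) = 0` and finitely many sections `s` OF `E|_{X₁}` generate it and embed `X₁ ↪ ℙⁿ_K`, THEN there are global
sections `b₀, …, b_m ∈ Γ(X, E)` which, for some `g ∉ 𝔭`, generate `E` on `X_g = X ×_A A_g` and, for some `r ∈ A_g` outside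
`𝔭A_g`, define a CLOSED IMMERSION `X_g ×_{A_g} (A_g)_r ↪ ℙ^m_{(A_g)_r}` over `Spec (A_g)_r` — `E` is very ample, with the `b_j`,
relative to the affine neighbourhood `Spec (A_g)_r` of `𝔭`.  Assembly of tree capital: the `Ext¹`-vanishing descends to the
`κ(𝔭)`-fibre (★ `Modules.subsingleton_ext_unit_succ_iff_of_isPullback_specMap`, [GortzWedhorn2023] Cor. 22.91), so `H⁰` commutes
with the base change `Spec K → Spec A` through `Spec A_𝔭` (★ `exists_tensor_secMod_top_linearEquiv_through_prime`, [MumfordAV1970]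
§5 Cor. 3) and the restricted global sections span `Γ(X₁, E|_{X₁})` over `K` (★ `span_range_unitSectionLE_eq_top_of_exists_linearEquiv`);
finitely many of them, `b`, span the `sᵢ`, hence generate along `X₁` and embed `X₁` (★ `isClosedImmersion_toProj_comap_of_span`);
this closed immersion DESCENDS along `Spec K → Spec κ(𝔭)` to the `κ(𝔭)`-fibre (★ `GeneratingSections.isClosedImmersion_toProj_of_comap`,
[StacksProject] Tag 02L6), and ★ `exists_isClosedImmersion_toProj_ofFrameSystem_away` ([EGAIII1] 4.7.1 core + Prop. 4.6.7 (ii))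
spreads it to the neighbourhood.  Cf. [EGAIII1] Thm. (4.7.1) (p. 145) — a different spine (no flatness, 𝔪-adic); here flat + `H¹`.
[cite: EGAIII1, Thm. (4.7.1) p. 145] [cite: MumfordAV1970, §5 Cor. 3 (p. 53)] [cite: GortzWedhorn2023, Thm. 24.46 (p. 397)]
[cite: StacksProject, Tag 0D2N] -/
theorem exists_globalSections_isClosedImmersion_toProj_away_of_fieldExtension :
    ∃ (m : ℕ) (b : Fin (m + 1) → Γ(E, ⊤)) (g : A), g ∉ 𝔭.asIdeal ∧
      ∃ (hcovg : ⨆ i, ⨆ a, (pullback f (Spec.map (CommRingCat.ofHom (algebraMap A (Localization.Away g))))).basicOpen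
          (((CocycleSections.ofFrameSystem F h1 b).comap
            (pullback.fst f (Spec.map (CommRingCat.ofHom (algebraMap A (Localization.Away g)))))).coeff i a) = ⊤),
      ∃ 𝔭₁ : PrimeSpectrum (Localization.Away g), PrimeSpectrum.comap (algebraMap A (Localization.Away g)) 𝔭₁ = 𝔭 ∧
      ∃ r : Localization.Away g, r ∉ 𝔭₁.asIdeal ∧ IsClosedImmersion
        (((ofCocycleSections (fun a => (pullback.fst f (Spec.map (CommRingCat.ofHom (algebraMap A (Localization.Away g))))) ⁻¹ᵁ F.U a)
            ((CocycleSections.ofFrameSystem F h1 b).comap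
              (pullback.fst f (Spec.map (CommRingCat.ofHom (algebraMap A (Localization.Away g)))))) hcovg).comap
          (pullback.fst (pullback.snd f (Spec.map (CommRingCat.ofHom (algebraMap A (Localization.Away g)))))
            (Spec.map (CommRingCat.ofHom (algebraMap (Localization.Away g) (Localization.Away r)))))).toProj
          (pullback.snd (pullback.snd f (Spec.map (CommRingCat.ofHom (algebraMap A (Localization.Away g)))))
            (Spec.map (CommRingCat.ofHom (algebraMap (Localization.Away g) (Localization.Away r)))))) := by
  classical
  -- Step 0: the `κ(𝔭)`-fibre `X₀` and the square `k : X₁ → X₀` over `Spec K → Spec κ(𝔭)`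
  set κ : Type := 𝔭.asIdeal.ResidueField with hκ
  let ικ : Spec (.of κ) ⟶ Spec (.of A) := Spec.map (CommRingCat.ofHom (algebraMap A κ))
  let X₀ : Scheme.{0} := pullback f ικ
  let iX : X₀ ⟶ X := pullback.fst f ικ
  let f₀ : X₀ ⟶ Spec (.of κ) := pullback.snd f ικ
  have HX : IsPullback iX f₀ f ικ := IsPullback.of_hasPullback f ικ
  haveI : IsProper f₀ := MorphismProperty.pullback_snd (P := @IsProper) f ικ inferInstance
  haveI : IsProper f₁ := MorphismProperty.of_isPullback H₁ inferInstance
  letI : Algebra κ K := φ.toAlgebra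
  have hφ : Spec.map (CommRingCat.ofHom φ) = Spec.map (CommRingCat.ofHom (algebraMap κ K)) := rfl
  let k : X₁ ⟶ X₀ := pullback.lift i₁ (f₁ ≫ Spec.map (CommRingCat.ofHom φ)) (by rw [Category.assoc]; exact H₁.w)
  have hk : k ≫ iX = i₁ := pullback.lift_fst _ _ _
  have hk' : k ≫ f₀ = f₁ ≫ Spec.map (CommRingCat.ofHom φ) := pullback.lift_snd _ _ _
  have Hk : IsPullback k f₁ f₀ (Spec.map (CommRingCat.ofHom (algebraMap κ K))) :=
    IsPullback.of_right (by rw [hk]; exact H₁) hk' HX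
  -- Step 1: `Ext¹`-vanishing descends to the `κ(𝔭)`-fibre ([GortzWedhorn2023] Cor. 22.91)
  have hvan₀ : Subsingleton (Ext.{1} (unitModule X₀) ((Scheme.Modules.pullback iX).obj E) 1) := by
    haveI := (F.isFiniteLocallyFree.pullback iX).isVectorBundle.1
    have hG : IsAffineLocalizing ((Scheme.Modules.pullback iX).obj E) := IsAffineLocalizing.of_isQuasicoherent _
    let Φ : (Scheme.Modules.pullback k).obj ((Scheme.Modules.pullback iX).obj E) ≅ (Scheme.Modules.pullback i₁).obj E :=
      (Scheme.Modules.pullbackComp k iX).app E ≪≫ (Scheme.Modules.pullbackCongr hk).app E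
    have h' : Subsingleton (Ext.{1} (unitModule X₁)
        ((Scheme.Modules.pullback k).obj ((Scheme.Modules.pullback iX).obj E)) 1) :=
      subsingleton_ext_of_iso' (unitModule X₁) Φ 1 hvan
    exact (subsingleton_ext_unit_succ_iff_of_isPullback_specMap (algebraMap κ K) Hk _ hG 0).mp h'
  -- Step 2: `H⁰` commutes with the base change `Spec K → Spec A`, which factors through `Spec A_𝔭` ([MumfordAV1970] §5 Cor. 3)
  let Ap : Type := Localization.AtPrime 𝔭.asIdeal
  let j' : Spec (.of K) ⟶ Spec (.of Ap) := Spec.map (CommRingCat.ofHom (φ.comp (IsLocalRing.residue Ap)))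
  have hj : j' ≫ Spec.map (CommRingCat.ofHom (algebraMap A Ap)) = Spec.map (CommRingCat.ofHom φ) ≫ ικ := by
    change Spec.map _ ≫ Spec.map _ = Spec.map _ ≫ Spec.map _
    rw [← Spec.map_comp, ← Spec.map_comp, ← CommRingCat.ofHom_comp, ← CommRingCat.ofHom_comp]
    rfl
  obtain ⟨Eeq, hEeq⟩ :=
    exists_tensor_secMod_top_linearEquiv_through_prime f E F.isFiniteLocallyFree 𝔭.asIdeal HX hvan₀ j' hj H₁
  letI : Algebra Γ(Spec (.of A), ⊤) Γ(Spec (.of K), ⊤) :=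
    ((Spec.map (CommRingCat.ofHom φ) ≫ ικ).appLE ⊤ ⊤ le_top).hom.toAlgebra
  have hspan := span_range_unitSectionLE_eq_top_of_exists_linearEquiv (p := f) (g' := f₁) (k := i₁) E ⟨Eeq, hEeq⟩
  -- Step 3: finitely many global sections `b` whose restrictions span the `sᵢ`
  letI : Inhabited (SecMod E f.appTop.hom ⊤) := ⟨SecMod.mk (ρ := f.appTop.hom) 0⟩
  obtain ⟨m, τ, hτ⟩ := exists_fin_subfamily_of_span_eq_top _ hspan
    (fun i ↦ SecMod.mk (L := (Scheme.Modules.pullback i₁).obj E) (ρ := f₁.appTop.hom) (U := ⊤) (s i))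
  let b : Fin (m + 1) → Γ(E, ⊤) := fun j ↦ SecMod.val (L := E) (ρ := f.appTop.hom) (τ j)
  -- Step 4: the `b` generate along `X₁` and their restrictions embed `X₁` ([EGAIII1] 4.7.1, span form)
  obtain ⟨hgen₁, hcov₁, Hemb₁⟩ := isClosedImmersion_toProj_comap_of_span i₁ f₁ F h1 h1₁ s hcov H b hτ
  -- Step 5: generation along the whole fibre `f⁻¹(𝔭)` (every point of it lies under `X₁`)
  have hgen : ∀ x : X, f x = 𝔭 → ∃ j, x ∈ X.basicOpen (coeffAt F h1 b j x) := by
    intro x hx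
    have hpt : f x = (Spec.map (CommRingCat.ofHom φ) ≫ ικ) (IsLocalRing.closedPoint K) := by
      rw [hx, Scheme.Hom.comp_apply]
      have e1 : (Spec.map (CommRingCat.ofHom φ)) (IsLocalRing.closedPoint K) = (⊥ : PrimeSpectrum κ) :=
        Subsingleton.elim _ _
      rw [e1]
      change 𝔭 = PrimeSpectrum.comap (algebraMap A κ) ⊥
      ext1
      rw [PrimeSpectrum.comap_asIdeal, PrimeSpectrum.asIdeal_bot, ← RingHom.ker_eq_comap_bot,
        Ideal.ker_algebraMap_residueField]
    obtain ⟨y, rfl⟩ := exists_eq_fst_of_isPullback' H₁ x _ hpt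
    exact hgen₁ y
  have hcov₀ : ⨆ j, ⨆ a, X₀.basicOpen (((CocycleSections.ofFrameSystem F h1 b).comap iX).coeff j a) = ⊤ :=
    iSup_basicOpen_comap_coeff_fibre_eq_top f (CocycleSections.ofFrameSystem F h1 b) 𝔭 HX (fun x hx ↦ by
      obtain ⟨i, hi⟩ := hgen x hx
      exact Opens.mem_iSup.mpr ⟨i, Opens.mem_iSup.mpr ⟨x, hi⟩⟩)
  -- Step 6: the embedding DESCENDS from the `K`-fibre to the `κ(𝔭)`-fibre ([StacksProject] Tag 02L6)
  have eD := ofCocycleSections_comap_of_comp_eq (CocycleSections.ofFrameSystem F h1 b) iX k i₁ hk hcov₀ hcov₁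
  haveI : IsClosedImmersion (((ofCocycleSections (fun a => iX ⁻¹ᵁ F.U a)
      ((CocycleSections.ofFrameSystem F h1 b).comap iX) hcov₀).comap k).toProj f₁) := by
    rw [eD]; exact Hemb₁
  obtain ⟨hsurj, hflat⟩ :=
    surjective_and_flat_SpecMap_of_field (κ := κ) (K := .of K) (CommRingCat.ofHom (algebraMap κ K))
  haveI := hsurj
  haveI := hflat
  have H₀ : IsClosedImmersion ((ofCocycleSections (fun a => iX ⁻¹ᵁ F.U a)
      ((CocycleSections.ofFrameSystem F h1 b).comap iX) hcov₀).toProj f₀) :=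
    GeneratingSections.isClosedImmersion_toProj_of_comap _ f₀ f₁ k Hk
  -- Step 7: spread to a neighbourhood ([EGAIII1] Thm. 4.7.1 core, Prop. 4.6.7 (ii))
  exact ⟨m, b, exists_isClosedImmersion_toProj_ofFrameSystem_away f F h1 b 𝔭 HX hgen hcov₀ H₀⟩

include H₁ hvan H in
/-- **THE VERY-AMPLE LOCUS IS OPEN — affine Noetherian base, every fibre over the neighbourhood.**  Under the hypotheses of
`exists_globalSections_isClosedImmersion_toProj_away_of_fieldExtension` (proper flat `f : X → Spec A`, `A` Noetherian, rank-one framed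
`E`, a fibre over a field extension of `κ(𝔭)` with `Ext¹(𝒪, E|) = 0` embedded by finitely many of its own sections of `E`), there are
global sections `b₀, …, b_m ∈ Γ(X, E)` and an OPEN `U ∋ 𝔭` of `Spec A` such that for EVERY ring-valued point `y : Spec K′ → Spec A`
landing in `U` and ANY cartesian square `X_y = X ×_A Spec K′`, the restrictions `η_y(b_j)` of the `b_j` generate `E|_{X_y}` and
define a CLOSED IMMERSION `X_y ↪ ℙ^m_{K′}` (read in the pulled-back frames `F|_{X_y}`).  `U` = the image of the open immersion
`Spec (A_g)_r → Spec A` of the previous theorem; `y` lifts through it (Mathlib `IsOpenImmersion.lift`, `Spec.map_surjective`),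
the embedding base-changes UP along the lift (★ `GeneratingSections.isClosedImmersion_toProj_comap`), and the base-changed
datum is the datum of the restricted sections (★ `ofCocycleSections_comap_of_comp_eq`, ★ `ofCocycleSections_ofFrameSystem_pullback`).
Cf. [EGAIII1] Thm. (4.7.1) (p. 145); [GortzWedhorn2023] Thm. 24.46; [StacksProject] Tag 0D2N.
[cite: EGAIII1, Thm. (4.7.1) p. 145] [cite: GortzWedhorn2023, Thm. 24.46 (p. 397)] [cite: Hartshorne1977, II Thm. 7.1] -/
theorem exists_opens_forall_isClosedImmersion_toProj_of_fieldExtension :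
    ∃ (m : ℕ) (b : Fin (m + 1) → Γ(E, ⊤)) (U : (Spec (.of A)).Opens), 𝔭 ∈ U ∧
      ∀ (K' : Type) [CommRing K'] (y : Spec (.of K') ⟶ Spec (.of A)), Set.range y ⊆ (U : Set _) →
        ∀ {Xy : Scheme.{0}} (iy : Xy ⟶ X) (fy : Xy ⟶ Spec (.of K')), IsPullback iy fy f y →
          ∃ hcov' : ⨆ i, ⨆ x, Xy.basicOpen ((CocycleSections.ofFrameSystem (F.pullback iy) (fun z ↦ h1 (iy.base z))
              (fun j ↦ unitSectionLE iy E (V := ⊤) (U := ⊤) le_top (b j))).coeff i x) = ⊤,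
            IsClosedImmersion ((ofCocycleSections (F.pullback iy).U (CocycleSections.ofFrameSystem (F.pullback iy)
              (fun z ↦ h1 (iy.base z)) (fun j ↦ unitSectionLE iy E (V := ⊤) (U := ⊤) le_top (b j))) hcov').toProj fy) := by
  obtain ⟨m, b, g, hg, hcovg, 𝔭₁, h𝔭₁, r, hr, Hci⟩ :=
    exists_globalSections_isClosedImmersion_toProj_away_of_fieldExtension f F h1 𝔭 φ H₁ hvan h1₁ s hcov H
  -- notation: the two localisations, the base changes, the open immersion `ι : Spec (A_g)_r → Spec A`
  let Ag : Type := Localization.Away g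
  let ιg : Spec (.of Ag) ⟶ Spec (.of A) := Spec.map (CommRingCat.ofHom (algebraMap A Ag))
  let Agr : Type := Localization.Away r
  let ιr : Spec (.of Agr) ⟶ Spec (.of Ag) := Spec.map (CommRingCat.ofHom (algebraMap Ag Agr))
  let jg : pullback f ιg ⟶ X := pullback.fst f ιg
  let fg : pullback f ιg ⟶ Spec (.of Ag) := pullback.snd f ιg
  let jr : pullback fg ιr ⟶ pullback f ιg := pullback.fst fg ιr
  let fgr : pullback fg ιr ⟶ Spec (.of Agr) := pullback.snd fg ιr
  let ι : Spec (.of Agr) ⟶ Spec (.of A) := ιr ≫ ιg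
  have big : IsPullback (jr ≫ jg) fgr f ι := (IsPullback.of_hasPullback fg ιr).paste_horiz (IsPullback.of_hasPullback f ιg)
  let S : CocycleSections (Fin (m + 1)) F.U := CocycleSections.ofFrameSystem F h1 b
  refine ⟨m, b, Scheme.Hom.opensRange ι, ?_, fun K' _ y hy Xy iy fy Hy ↦ ?_⟩
  · -- `𝔭` lies under the prime `𝔭A_g (A_g)_r`
    obtain ⟨𝔭₂, h𝔭₂⟩ := exists_primeSpectrum_away_comap_eq 𝔭₁ r hr
    refine ⟨𝔭₂, ?_⟩
    change (ιr ≫ ιg) 𝔭₂ = 𝔭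
    rw [Scheme.Hom.comp_apply]
    change PrimeSpectrum.comap (algebraMap A Ag) (PrimeSpectrum.comap (algebraMap Ag Agr) 𝔭₂) = 𝔭
    rw [h𝔭₂, h𝔭₁]
  · -- lift `y` through the open immersion `ι` and read it as `Spec` of a ring map
    let y' : Spec (.of K') ⟶ Spec (.of Agr) := IsOpenImmersion.lift ι y hy
    have hy' : y' ≫ ι = y := IsOpenImmersion.lift_fac ι y hy
    obtain ⟨ψ, hψ⟩ := Spec.map_surjective y'
    letI : Algebra Agr K' := ψ.hom.toAlgebra
    have hψ' : Spec.map (CommRingCat.ofHom (algebraMap Agr K')) = y' := hψ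
    -- the given fibre sits over `X_g ×_{A_g} (A_g)_r` by a cartesian square over `y'`
    let h : Xy ⟶ pullback fg ιr := big.lift iy (fy ≫ y') (by rw [Category.assoc, hy']; exact Hy.w)
    have hh₁ : h ≫ (jr ≫ jg) = iy := big.lift_fst _ _ _
    have hh₂ : h ≫ fgr = fy ≫ y' := big.lift_snd _ _ _
    have Hh : IsPullback h fy fgr (Spec.map (CommRingCat.ofHom (algebraMap Agr K'))) := by
      rw [hψ']
      exact IsPullback.of_right (by rw [hh₁, hy']; exact Hy) hh₂ big
    -- UP: the embedding base-changes along `y'`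
    haveI := Hci
    have Hy' := GeneratingSections.isClosedImmersion_toProj_comap
      ((ofCocycleSections (fun a => jg ⁻¹ᵁ F.U a) (S.comap jg) hcovg).comap jr) fgr fy h Hh
    -- the base-changed datum is the datum of `b` restricted along `iy`
    have e : (h ≫ jr) ≫ jg = iy := by rw [Category.assoc]; exact hh₁
    have hcovy : ⨆ i, ⨆ a, Xy.basicOpen ((S.comap iy).coeff i a) = ⊤ := by
      rw [← e]
      exact CocycleSections.iSup_basicOpen_comap_coeff (h ≫ jr) (S.comap jg) hcovg
    have eD : ((ofCocycleSections (fun a => jg ⁻¹ᵁ F.U a) (S.comap jg) hcovg).comap jr).comap h =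
        ofCocycleSections (fun a => iy ⁻¹ᵁ F.U a) (S.comap iy) hcovy := by
      rw [← comap_comp]
      exact ofCocycleSections_comap_of_comp_eq S jg (h ≫ jr) iy e hcovg hcovy
    rw [eD] at Hy'
    -- read it in the pulled-back frames
    have h1y : ∀ z, (F.pullback iy).rank z = 1 := fun z ↦ h1 (iy.base z)
    have hW : ⨆ z : Xy, (fun a => iy ⁻¹ᵁ F.U a) (iy.base z) = ⊤ :=
      top_le_iff.mp fun z _ ↦ Opens.mem_iSup.mpr ⟨z, F.mem (iy.base z)⟩
    have hcov' : ⨆ i, ⨆ x, Xy.basicOpen ((CocycleSections.ofFrameSystem (F.pullback iy) h1y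
        (fun j ↦ unitSectionLE iy E (V := ⊤) (U := ⊤) le_top (b j))).coeff i x) = ⊤ := by
      rw [ofFrameSystem_pullback_eq_precomp_comap iy F h1 b h1y]
      exact (S.comap iy).iSup_basicOpen_precomp_coeff_eq_top iy.base hW hcovy
    refine ⟨hcov', ?_⟩
    rw [ofCocycleSections_ofFrameSystem_pullback iy F h1 b h1y hcov' hcovy]
    exact Hy'


end Away

end Literature.AlgebraicGeometry.Morphisms

end
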